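import Literature.MathematicalPhysics.KineticTheory.HardSphereEulerLLN
import Literature.MathematicalPhysics.KineticTheory.HardSphereEuler
import Literature.Analysis.FunctionSpaces.TorusCalculus
import Summits.AtomisticToContinuum.HydrodynamicLimit.Theorems.ImplosionDichotomyPolynomialCompressionStaticsSmoothRate
import Mathlib.Analysis.Analytic.OfScalars
import Mathlib.Analysis.Analytic.ChangeOrigin
import Mathlib.Analysis.Calculus.FDeriv.Analytic
import Mathlib.Analysis.Calculus.InverseFunctionTheorem.Analytic
import Mathlib.Analysis.Calculus.SmoothSeries
import Mathlib.Analysis.Complex.ExponentialBounds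

/-!
# Non-smooth profiles carry no classical solution with the pinned data (stub `stub_nonsmoothVacuous`)

Crux `Summit.AtomisticToContinuum.HydrodynamicLimit.Theses.ImplosionDichotomy.DiluteSelfConsistency`
(stmt-AtomisticToContinuum-3091; `Iff.rfl`-equal copy `Theses.ImplosionLoophole.DiluteSelfConsistency`),
line `birth` (rev c2), stub `stub_nonsmoothVacuous` — the reduction of the crux to SMOOTH profiles.

If the continuous positive profiles `(a₀, θ₀, u₀)` on `𝕋³` are not all `Torus.IsSmooth`, then below an
explicit threshold `σ₀ = σ₀(a₀) > 0` no classical hard-sphere-Euler solution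
`IsHardSphereEulerSolution σ T ρ u θ` with the pinned time-`0` data
`(rhoLim (profileOf a₀) σ, u₀, θ₀)` lives on a nonempty interval `[0, T)`: `T ≤ 0`.

## Proof

Suppose `0 < T`. Time-`0` slices of the jointly smooth fields are smooth
(`Torus.IsSmoothSpaceTimeOn.isSmooth_slice`), so `u₀ = u 0`, `θ₀ = θ 0` and
`rhoLim (profileOf a₀) σ = ρ 0` are smooth. It remains to see that smoothness of `rhoLim P σ`
forces smoothness of `β = P.β = a₀ / ∫ a₀` (hence of `a₀ = (∫ a₀) β`) once `σ` is small. Now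
`rhoLim P σ x = G (β x)` with the ONE-VARIABLE cluster series
`G b = ∑_j c_j b^{j+1}`, `c_j = γ_{j+1} R^{j+1}` (written out in full below; no definitions are
introduced), whose coefficients obey `|c_j| M^j ≤ 2e θ^j` (`θ = geomRatio P σ`, `M = sup β`;
`abs_coef_mul_pow_le`). Hence `G` is the
sum of a real power series of radius `≥ 2M` (for `θ ≤ 1/4`), so it is real-analytic on `|b| < 2M`
(Mathlib `FormalMultilinearSeries.ofScalars`, `hasFPowerSeriesOnBall`, `analyticAt_of_mem`); its
derivative is `G'(b) = ∑_j (j+1) c_j b^j` (`hasDerivAt_tsum_of_isPreconnected`), and on `[0, M]`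
`G'(b) ≥ R - 8eθ ≥ 1/2 - 3/8 > 0` for `θ ≤ 1/64` (`c_0 = R ≥ 1/2`, `γ₁ = 1`). By the analytic inverse
function theorem (`AnalyticAt.analyticAt_localInverse`) `G` has an analytic local inverse `H` at
each `b₀ = β(x₀)`, and by continuity of `β`, `lift β = H ∘ lift (rhoLim P σ)` near every point of
`ℝ³`; so `lift β` is `C^∞`. The threshold: `SmallDensity P σ` and `θ ≤ 1/64` hold for
`σ < σ₁/4`, `σ₁` the `exists_smallDensity` threshold (`θ(4σ) = 64 θ(σ) < 1`).

prover-line-stmt-AtomisticToContinuum-3091-c2-0 (line `birth`, rev c2; stub-worker draft, finished by the lead).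
-/

noncomputable section

namespace Summit.AtomisticToContinuum.HydrodynamicLimit.Theorems

open MeasureTheory Filter Set Topology
open Literature.MathematicalPhysics.KineticTheory Literature.Analysis.FluidPDE Literature.Analysis.FunctionSpaces
open scoped ContDiff ENNReal NNReal

namespace DiluteSelfConsistencyNonsmoothVacuous

variable {P : DensityProfile} {σ : ℝ}

/-! ## The one-variable cluster series -/

/-- `lift (rhoLim P σ) = G ∘ lift β` pointwise (definitional). [folklore] -/
theorem clusterFn_lift_β (y : EuclideanSpace ℝ (Fin 3)) :
    (∑' j : ℕ, clusterCoeff σ j * ratioLimit P σ ^ (j + 1) * Torus.lift P.β y ^ (j + 1)) =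
      Torus.lift (rhoLim P σ) y := rfl

/-- The coefficient bound `|c_j| M^j ≤ 2e θʲ` (from `|γ_{j+1} R^{j+1}| M^{j+1} ≤ 2eM θʲ`). [folklore] -/
theorem abs_coef_mul_pow_le (h : SmallDensity P σ) (j : ℕ) :
    |(clusterCoeff σ j * ratioLimit P σ ^ (j + 1))| * P.M ^ j ≤ 2 * Real.exp 1 * geomRatio P σ ^ j := by
  have h1 := StaticsSmoothRate.abs_coeff_mul_pow_le h j
  have hM := P.M_pos
  have h2 : |(clusterCoeff σ j * ratioLimit P σ ^ (j + 1))| * P.M ^ j * P.M ≤ 2 * Real.exp 1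
      * geomRatio P σ ^ j * P.M := by
    calc |(clusterCoeff σ j * ratioLimit P σ ^ (j + 1))| * P.M ^ j * P.M
        = |clusterCoeff σ j * ratioLimit P σ ^ (j + 1)| * P.M ^ (j + 1) := by rw [pow_succ]; ring
      _ ≤ 2 * Real.exp 1 * P.M * geomRatio P σ ^ j := h1
      _ = 2 * Real.exp 1 * geomRatio P σ ^ j * P.M := by ring
  exact le_of_mul_le_mul_right h2 hM

/-! ## Analyticity: `G` is the sum of a power series of radius `≥ 2M` -/

/-- The radius of the power series `∑_n d_n b^n` is at least `2M` when `θ ≤ 1/4`: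
`|d_{j+1}| (2M)^{j+1} = 2M · 2ʲ |c_j| Mʲ ≤ 4eM (2θ)ʲ ≤ 4eM`. [folklore] -/
theorem ofReal_le_radius (h : SmallDensity P σ) (hθ : geomRatio P σ ≤ 1 / 4) :
    ENNReal.ofReal (2 * P.M) ≤ (FormalMultilinearSeries.ofScalars ℝ
        (fun n : ℕ => Nat.rec (motive := fun _ => ℝ) 0 (fun j _ => clusterCoeff σ j
        * ratioLimit P σ ^ (j + 1)) n)).radius := by
  have hM := P.M_pos
  have hθ0 := h.geomRatio_nonneg
  rw [ENNReal.ofReal_eq_coe_nnreal (by positivity : (0 : ℝ) ≤ 2 * P.M)]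
  refine FormalMultilinearSeries.le_radius_of_bound _ (4 * Real.exp 1 * P.M) fun n => ?_
  rw [FormalMultilinearSeries.ofScalars_norm, NNReal.coe_mk, Real.norm_eq_abs]
  cases n with
  | zero =>
      simp only [Nat.rec_zero, abs_zero, zero_mul]
      positivity
  | succ j =>
      have hc := abs_coef_mul_pow_le h j
      calc |(clusterCoeff σ j * ratioLimit P σ ^ (j + 1))| * (2 * P.M) ^ (j + 1)
          = |(clusterCoeff σ j * ratioLimit P σ ^ (j + 1))| * P.M ^ j * (2 * P.M)
              * (2 : ℝ) ^ j := by rw [mul_pow]; ring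
        _ ≤ 2 * Real.exp 1 * geomRatio P σ ^ j * (2 * P.M) * (2 : ℝ) ^ j := by gcongr
        _ = 4 * Real.exp 1 * P.M * (2 * geomRatio P σ) ^ j := by rw [mul_pow]; ring
        _ ≤ 4 * Real.exp 1 * P.M * 1 := by
            gcongr
            exact pow_le_one₀ (by positivity) (by linarith)
        _ = 4 * Real.exp 1 * P.M := mul_one _

/-- The sum of the power series `∑_n d_n b^n` is `G` (everywhere: the zeroth term vanishes, and the two
series are summable together). [folklore] -/
theorem ofScalars_sum_eq_clusterFn :
    (FormalMultilinearSeries.ofScalars ℝ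
        (fun n : ℕ => Nat.rec (motive := fun _ => ℝ) 0 (fun j _ => clusterCoeff σ j
        * ratioLimit P σ ^ (j + 1)) n)).sum =
        (fun b : ℝ => ∑' j : ℕ, clusterCoeff σ j * ratioLimit P σ ^ (j + 1) * b ^ (j + 1)) := by
  funext b
  have h1 : (FormalMultilinearSeries.ofScalars ℝ
      (fun n : ℕ => Nat.rec (motive := fun _ => ℝ) 0 (fun j _ => clusterCoeff σ j
      * ratioLimit P σ ^ (j + 1)) n)).sum b =
      ∑' n,
          (fun n : ℕ => Nat.rec (motive := fun _ => ℝ) 0 (fun j _ => clusterCoeff σ j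
          * ratioLimit P σ ^ (j + 1)) n) n * b ^ n := by
    simpa only [FormalMultilinearSeries.ofScalarsSum, smul_eq_mul] using
      FormalMultilinearSeries.ofScalars_sum_eq
          (fun n : ℕ => Nat.rec (motive := fun _ => ℝ) 0 (fun j _ => clusterCoeff σ j * ratioLimit P σ ^ (j + 1)) n) b
  rw [h1]
  by_cases hs : Summable fun n =>
      (fun n : ℕ => Nat.rec (motive := fun _ => ℝ) 0 (fun j _ => clusterCoeff σ j
      * ratioLimit P σ ^ (j + 1)) n) n * b ^ n
  · rw [hs.tsum_eq_zero_add]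
    simp only [Nat.rec_zero, zero_mul, zero_add]
  · have hs' : ¬Summable fun j => (clusterCoeff σ j * ratioLimit P σ ^ (j + 1)) * b ^ (j + 1) := fun H =>
      hs ((summable_nat_add_iff 1).1 (by simpa only [Nat.rec_add_one] using H))
    rw [tsum_eq_zero_of_not_summable hs, tsum_eq_zero_of_not_summable hs']

/-- `G` is real-analytic on `|b| < 2M` when `θ ≤ 1/4`. [folklore] -/
theorem analyticAt_clusterFn (h : SmallDensity P σ) (hθ : geomRatio P σ ≤ 1 / 4) {b : ℝ}
    (hb : |b| < 2 * P.M) : AnalyticAt ℝ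
        (fun b : ℝ => ∑' j : ℕ, clusterCoeff σ j * ratioLimit P σ ^ (j + 1) * b ^ (j + 1)) b := by
  have hM := P.M_pos
  have hR := ofReal_le_radius h hθ
  have hpos : 0 < ENNReal.ofReal (2 * P.M) := ENNReal.ofReal_pos.2 (by positivity)
  have hball : b ∈ Metric.eball (0 : ℝ) (FormalMultilinearSeries.ofScalars ℝ
      (fun n : ℕ => Nat.rec (motive := fun _ => ℝ) 0 (fun j _ => clusterCoeff σ j
      * ratioLimit P σ ^ (j + 1)) n)).radius := by
    refine Metric.eball_subset_eball hR ?_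
    rw [Metric.mem_eball, edist_lt_ofReal, Real.dist_eq, sub_zero]
    exact hb
  have hA := ((FormalMultilinearSeries.ofScalars ℝ
      (fun n : ℕ => Nat.rec (motive := fun _ => ℝ) 0 (fun j _ => clusterCoeff σ j
      * ratioLimit P σ ^ (j + 1)) n)).hasFPowerSeriesOnBall
    (hpos.trans_le hR)).analyticAt_of_mem hball
  rwa [ofScalars_sum_eq_clusterFn] at hA

/-! ## The derivative of `G` and its positivity on `[0, M]` -/

/-- Termwise differentiation: `G'(b) = ∑_j (j+1) c_j bʲ` on `(-2M, 2M)` when `θ ≤ 1/8`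
(derivative bound `|(j+1) c_j bʲ| ≤ 2e (4θ)ʲ` there). [folklore] -/
theorem hasDerivAt_clusterFn (h : SmallDensity P σ) (hθ : geomRatio P σ ≤ 1 / 8) {b : ℝ}
    (hb : b ∈ Ioo (-(2 * P.M)) (2 * P.M)) :
    HasDerivAt
        (fun b : ℝ => ∑' j : ℕ, clusterCoeff σ j * ratioLimit P σ ^ (j + 1)
        * b ^ (j + 1)) (∑' n, (clusterCoeff σ n * ratioLimit P σ ^ (n + 1) * ((n : ℝ) + 1) * b ^ n)) b := by
  have hM := P.M_pos
  have hθ0 := h.geomRatio_nonneg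
  have hu : Summable fun n : ℕ => 2 * Real.exp 1 * (4 * geomRatio P σ) ^ n :=
    (summable_geometric_of_lt_one (by positivity) (by linarith)).mul_left _
  have hderiv : ∀ (n : ℕ) (z : ℝ), z ∈ Ioo (-(2 * P.M)) (2 * P.M) →
      HasDerivAt (fun z => (clusterCoeff σ n * ratioLimit P σ ^ (n + 1)) * z ^ (n + 1)) ((clusterCoeff σ n
          * ratioLimit P σ ^ (n + 1) * ((n : ℝ) + 1) * z ^ n)) z := fun n z _ => by
    have e := (hasDerivAt_pow (n + 1) z).const_mul ((clusterCoeff σ n * ratioLimit P σ ^ (n + 1)))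
    simp only [Nat.add_sub_cancel] at e
    push_cast at e
    simpa only [mul_assoc] using e
  have hbound : ∀ (n : ℕ) (z : ℝ), z ∈ Ioo (-(2 * P.M)) (2 * P.M) →
      ‖(clusterCoeff σ n * ratioLimit P σ ^ (n + 1)
          * ((n : ℝ) + 1) * z ^ n)‖ ≤ 2 * Real.exp 1 * (4 * geomRatio P σ) ^ n := fun n z hz => by
    have hz2 : |z| ≤ 2 * P.M := abs_le.2 ⟨hz.1.le, hz.2.le⟩
    have hn : (n : ℝ) + 1 ≤ 2 ^ n := by exact_mod_cast Nat.lt_two_pow_self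
    have hc := abs_coef_mul_pow_le h n
    have h4 : (4 : ℝ) ^ n = 2 ^ n * 2 ^ n := by rw [← mul_pow]; norm_num
    rw [Real.norm_eq_abs, abs_mul, abs_mul, abs_pow,
      abs_of_nonneg (by positivity : (0 : ℝ) ≤ (n : ℝ) + 1)]
    calc |(clusterCoeff σ n * ratioLimit P σ ^ (n + 1))|
        * ((n : ℝ) + 1) * |z| ^ n ≤ |(clusterCoeff σ n * ratioLimit P σ ^ (n + 1))| * 2 ^ n * (2
        * P.M) ^ n := by gcongr
      _ = |(clusterCoeff σ n * ratioLimit P σ ^ (n + 1))| * P.M ^ n * (4 : ℝ) ^ n := by rw [mul_pow, h4]; ring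
      _ ≤ 2 * Real.exp 1 * geomRatio P σ ^ n * 4 ^ n := by gcongr
      _ = 2 * Real.exp 1 * (4 * geomRatio P σ) ^ n := by rw [mul_pow]; ring
  have h0 : (0 : ℝ) ∈ Ioo (-(2 * P.M)) (2 * P.M) := ⟨by linarith, by linarith⟩
  have hs0 : Summable fun n => (clusterCoeff σ n * ratioLimit P σ ^ (n + 1))
      * (0 : ℝ) ^ (n + 1) := by simp [summable_zero]
  exact hasDerivAt_tsum_of_isPreconnected hu isOpen_Ioo isPreconnected_Ioo hderiv hbound h0 hs0 hb

/-- Tail bound for the derivative series on `[0, M]`, `θ ≤ 1/4`: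
`|(j+2) c_{j+1} b^{j+1}| ≤ 2eθ (j+2) θʲ ≤ 4eθ 2^{-j}`. [folklore] -/
theorem norm_dterm_succ_le (h : SmallDensity P σ) (hθ : geomRatio P σ ≤ 1 / 4) {b : ℝ} (hb0 : 0 ≤ b)
    (hbM : b ≤ P.M) (n : ℕ) :
    ‖(clusterCoeff σ (n + 1) * ratioLimit P σ ^ ((n + 1) + 1)
        * ((n + 1 : ℝ) + 1) * b ^ (n + 1))‖ ≤ 4 * Real.exp 1 * geomRatio P σ * (1 / 2) ^ n := by
  have hθ0 := h.geomRatio_nonneg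
  have hc := abs_coef_mul_pow_le h (n + 1)
  have h1 : n + 2 ≤ 2 ^ (n + 1) := Nat.lt_two_pow_self
  have hn2 : (n : ℝ) + 2 ≤ 2 * 2 ^ n := by
    have h2 := (Nat.cast_le (α := ℝ)).2 h1
    push_cast at h2
    rw [pow_succ] at h2
    linarith
  rw [Real.norm_eq_abs, abs_mul, abs_mul, abs_pow, abs_of_nonneg hb0,
    abs_of_nonneg (by positivity : (0 : ℝ) ≤ (n : ℝ) + 1 + 1)]
  calc |(clusterCoeff σ (n + 1) * ratioLimit P σ ^ ((n + 1) + 1))| * ((n : ℝ) + 1 + 1) * b ^ (n + 1)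
      ≤ |(clusterCoeff σ (n + 1) * ratioLimit P σ ^ ((n + 1) + 1))| * ((n : ℝ) + 1 + 1) * P.M ^ (n + 1) := by gcongr
    _ = |(clusterCoeff σ (n + 1) * ratioLimit P σ ^ ((n + 1) + 1))| * P.M ^ (n + 1) * ((n : ℝ) + 2) := by ring
    _ ≤ 2 * Real.exp 1 * geomRatio P σ ^ (n + 1) * (2 * 2 ^ n) :=
        mul_le_mul hc hn2 (by positivity) (by positivity)
    _ = 4 * Real.exp 1 * geomRatio P σ * (2 * geomRatio P σ) ^ n := by rw [mul_pow, pow_succ]; ring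
    _ ≤ 4 * Real.exp 1 * geomRatio P σ * (1 / 2) ^ n := by
        gcongr
        linarith

/-- **Positivity of `G'` on `[0, M]`** for `θ ≤ 1/64`: `G'(b) = R + ∑_{j ≥ 1} (j+1) c_j bʲ ≥ R - 8eθ > 0`
(`c_0 = R ≥ 1/2` by `γ₁ = 1`). [folklore] -/
theorem tsum_dterm_pos (h : SmallDensity P σ) (hθ : geomRatio P σ ≤ 1 / 64) {b : ℝ} (hb0 : 0 ≤ b)
    (hbM : b ≤ P.M) : 0 < ∑' n, (clusterCoeff σ n * ratioLimit P σ ^ (n + 1) * ((n : ℝ) + 1) * b ^ n) := by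
  have hθ0 := h.geomRatio_nonneg
  have hbd : ∀ n, ‖(clusterCoeff σ (n + 1) * ratioLimit P σ ^ ((n + 1) + 1)
      * ((n + 1 : ℝ) + 1) * b ^ (n + 1))‖ ≤ 4 * Real.exp 1 * geomRatio P σ * (1 / 2) ^ n :=
    norm_dterm_succ_le h (by linarith) hb0 hbM
  have hs1 : Summable fun n => (clusterCoeff σ (n + 1) * ratioLimit P σ ^ ((n + 1) + 1)
      * ((n + 1 : ℝ) + 1) * b ^ (n + 1)) :=
    Summable.of_norm_bounded (summable_geometric_two.mul_left _) hbd
  have hs : Summable fun n => (clusterCoeff σ n * ratioLimit P σ ^ (n + 1) * ((n : ℝ) + 1) * b ^ n) := by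
    refine (summable_nat_add_iff 1).1 ?_
    simpa only [Nat.cast_succ] using hs1
  have htail : ‖∑' n, (clusterCoeff σ (n + 1) * ratioLimit P σ ^ ((n + 1) + 1)
      * ((n + 1 : ℝ) + 1) * b ^ (n + 1))‖ ≤ 4 * Real.exp 1 * geomRatio P σ * 2 :=
    tsum_of_norm_bounded (hasSum_geometric_two.mul_left _) hbd
  have htail' : |∑' n : ℕ, clusterCoeff σ (n + 1) * ratioLimit P σ ^ (n + 1 + 1) * (((n + 1 : ℕ) : ℝ) + 1) *
      b ^ (n + 1)| ≤ 4 * Real.exp 1 * geomRatio P σ * 2 := by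
    simpa only [Nat.cast_succ, Real.norm_eq_abs] using htail
  have h0 : clusterCoeff σ 0 * ratioLimit P σ ^ (0 + 1) * (((0 : ℕ) : ℝ) + 1) * b ^ 0 = ratioLimit P σ := by
    simp [StaticsSmoothRate.clusterCoeff_zero h]
  rw [hs.tsum_eq_zero_add, h0]
  have hR := h.ratioLimit_mem.1
  have he : Real.exp 1 < 3 := Real.exp_one_lt_d9.trans (by norm_num)
  have heθ : Real.exp 1 * geomRatio P σ ≤ 3 * (1 / 64) :=
    mul_le_mul he.le hθ hθ0 (by norm_num)
  have habs := neg_abs_le (∑' n : ℕ, clusterCoeff σ (n + 1) * ratioLimit P σ ^ (n + 1 + 1) *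
    (((n + 1 : ℕ) : ℝ) + 1) * b ^ (n + 1))
  linarith

/-! ## Smoothness of `β` from smoothness of `rhoLim P σ` -/

/-- **Inverting the cluster series.** If `SmallDensity P σ`, `θ ≤ 1/64` and `rhoLim P σ` is smooth on
`𝕋³`, then the profile `β` is smooth: near each point, `lift β = H ∘ lift (rhoLim P σ)` with `H` the
analytic local inverse of `G` at `β(x₀)` (`G' > 0` on `[0, M]`, analytic inverse function theorem).
[folklore] -/
theorem isSmooth_β_of_isSmooth_rhoLim (h : SmallDensity P σ) (hθ : geomRatio P σ ≤ 1 / 64)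
    (hρ : Torus.IsSmooth (rhoLim P σ)) : Torus.IsSmooth P.β := by
  have hM := P.M_pos
  show ContDiff ℝ ∞ (Torus.lift P.β)
  refine contDiff_iff_contDiffAt.2 fun y => ?_
  have hb0 : 0 < Torus.lift P.β y := P.pos _
  have hbM : Torus.lift P.β y ≤ P.M := P.le_M _
  -- `G` is analytic at `b₀ = β (proj y)` with nonvanishing derivative
  have hGa : AnalyticAt ℝ
      (fun b : ℝ => ∑' j : ℕ, clusterCoeff σ j * ratioLimit P σ ^ (j + 1) * b ^ (j + 1)) (Torus.lift P.β y) :=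
    analyticAt_clusterFn h (by linarith) (by rw [abs_of_pos hb0]; linarith)
  have hD : HasDerivAt
      (fun b : ℝ => ∑' j : ℕ, clusterCoeff σ j * ratioLimit P σ ^ (j + 1)
      * b ^ (j + 1)) (∑' n, (clusterCoeff σ n * ratioLimit P σ ^ (n + 1)
      * ((n : ℝ) + 1) * Torus.lift P.β y ^ n)) (Torus.lift P.β y) :=
    hasDerivAt_clusterFn h (by linarith) ⟨by linarith, by linarith⟩
  have hne : deriv
      (fun b : ℝ => ∑' j : ℕ, clusterCoeff σ j * ratioLimit P σ ^ (j + 1) * b ^ (j + 1)) (Torus.lift P.β y) ≠ 0 := by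
    rw [hD.deriv]
    exact (tsum_dterm_pos h hθ hb0.le hbM).ne'
  -- the analytic local inverse `H` of `G` at `b₀`
  have hH := hGa.analyticAt_localInverse hne
  have hleft := hGa.hasStrictDerivAt.eventually_left_inverse hne
  -- `lift β = H ∘ lift (rhoLim P σ)` near `y`, by continuity of `lift β`
  have hc : ContinuousAt (Torus.lift P.β) y := (P.continuous.comp Torus.continuous_proj).continuousAt
  have hev := hc.eventually hleft
  have hEq : Torus.lift P.β =ᶠ[𝓝 y]
      (hGa.hasStrictDerivAt.localInverse
          (fun b : ℝ => ∑' j : ℕ, clusterCoeff σ j * ratioLimit P σ ^ (j + 1)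
          * b ^ (j + 1)) _ _ hne) ∘ Torus.lift (rhoLim P σ) := by
    filter_upwards [hev] with z hz
    rw [clusterFn_lift_β] at hz
    exact hz.symm
  have hcomp : ContDiffAt ℝ ∞
      ((hGa.hasStrictDerivAt.localInverse
          (fun b : ℝ => ∑' j : ℕ, clusterCoeff σ j * ratioLimit P σ ^ (j + 1)
          * b ^ (j + 1)) _ _ hne) ∘ Torus.lift (rhoLim P σ)) y :=
    ContDiffAt.comp y (by rw [← clusterFn_lift_β]; exact hH.contDiffAt) hρ.contDiffAt
  exact hcomp.congr_of_eventuallyEq hEq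

/-- **The threshold.** There is `σ₀ = σ₀(β) > 0` such that `SmallDensity P σ` and `θ ≤ 1/64` for all
`0 < σ < σ₀`: take `σ₀ = σ₁/4` with `σ₁` the threshold of `exists_smallDensity`, since
`θ(4σ) = 64 θ(σ) < 1`. [folklore] -/
theorem exists_threshold (P : DensityProfile) :
    ∃ σ₀ : ℝ, 0 < σ₀ ∧ ∀ σ : ℝ, 0 < σ → σ < σ₀ → SmallDensity P σ ∧ geomRatio P σ ≤ 1 / 64 := by
  obtain ⟨σ₁, hσ₁, H⟩ := exists_smallDensity P one_pos
  refine ⟨σ₁ / 4, by positivity, fun σ hσ hσlt => ⟨(H σ hσ (by linarith)).1, ?_⟩⟩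
  have h4 := (H (4 * σ) (by positivity) (by linarith)).1.geomRatio_lt_one
  have e4 : geomRatio P (4 * σ) = 64 * geomRatio P σ := by
    simp only [geomRatio, ovDensity]
    ring
  linarith

end DiluteSelfConsistencyNonsmoothVacuous

open DiluteSelfConsistencyNonsmoothVacuous in
/-- **Stub `stub_nonsmoothVacuous` (smooth reduction of `DiluteSelfConsistency`, line `birth` rev c2):
non-smooth profiles carry no classical solution with the pinned data.** For continuous positive
profiles `(a₀, θ₀, u₀)` on `𝕋³` that are NOT all `Torus.IsSmooth` there is `σ₀ > 0` such that for
`0 < σ < σ₀` every classical hard-sphere-Euler solution on `[0, T)` with the pinned data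
`ρ 0 = rhoLim (profileOf a₀) σ`, `u 0 = u₀`, `θ 0 = θ₀` has `T ≤ 0`: otherwise the time-`0` slices
are smooth (`Torus.IsSmoothSpaceTimeOn.isSmooth_slice`), and `rhoLim (profileOf a₀) σ` smooth forces
`a₀ = (∫ a₀) · β` smooth (`isSmooth_β_of_isSmooth_rhoLim`). [folklore] -/
theorem stub_nonsmoothVacuous :
    ∀ (a₀ θ₀ : T3 → ℝ) (u₀ : T3 → V3) (ha : Continuous a₀) (ha0 : ∀ x, 0 < a₀ x),
      Continuous θ₀ → Continuous u₀ → (∀ x, 0 < θ₀ x) →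
      ¬ (Torus.IsSmooth a₀ ∧ Torus.IsSmooth θ₀ ∧ Torus.IsSmooth u₀) →
      ∃ σ₀ : ℝ, 0 < σ₀ ∧ ∀ σ : ℝ, 0 < σ → σ < σ₀ →
        ∀ (T : ℝ) (ρ θ : ℝ → T3 → ℝ) (u : ℝ → T3 → V3), IsHardSphereEulerSolution σ T ρ u θ →
          ρ 0 = rhoLim (profileOf a₀ ha ha0) σ → u 0 = u₀ → θ 0 = θ₀ → T ≤ 0 := by
  intro a₀ θ₀ u₀ ha ha0 _ _ _ hns
  obtain ⟨σ₀, hσ₀, H⟩ := exists_threshold (profileOf a₀ ha ha0)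
  refine ⟨σ₀, hσ₀, fun σ hσ hσlt T ρ θ u hE h1 h2 h3 => ?_⟩
  by_contra hT
  have h0 : (0 : ℝ) ∈ Ico 0 T := ⟨le_rfl, lt_of_not_ge hT⟩
  obtain ⟨h, hθ⟩ := H σ hσ hσlt
  refine hns ⟨?_, ?_, ?_⟩
  · -- `ρ 0 = rhoLim (profileOf a₀) σ` is smooth, hence so are `β = a₀ / ∫ a₀` and `a₀ = (∫ a₀) β`
    have hρs : Torus.IsSmooth (rhoLim (profileOf a₀ ha ha0) σ) := by
      rw [← h1]
      exact hE.smooth_density.isSmooth_slice h0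
    have hβ := isSmooth_β_of_isSmooth_rhoLim h hθ hρs
    have hI := (integral_pos_of_continuous_pos ha ha0).ne'
    have hae : Torus.lift a₀ = fun y => (∫ z, a₀ z) * Torus.lift (profileOf a₀ ha ha0).β y := by
      funext y
      simp only [Torus.lift_apply, profileOf_β]
      field_simp
    show ContDiff ℝ ∞ (Torus.lift a₀)
    rw [hae]
    exact contDiff_const.mul hβ
  · rw [← h3]
    exact hE.smooth_temperature.isSmooth_slice h0
  · rw [← h2]
    exact hE.smooth_velocity.isSmooth_slice h0

end Summit.AtomisticToContinuum.HydrodynamicLimit.Theorems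

end
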